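import Summits.Parity.GeneralizedHardyLittlewood.Theorems.GreenTaoLevelTwoMNTwoApproxLinear
import Summits.Parity.GeneralizedHardyLittlewood.Theorems.GreenTaoLevelTwoMNTwoMoebiusTransfer

/-!
# Route `GreenTaoLevelTwo`, crux `MNTwo` (stmt-Parity-21276), line `birth`, stub `stub_mnVertical`:
# Möbius is orthogonal to almost linear phases — one residue class in `ℤ/pℤ` (GT 2008b Prop. 15)

Block V2 of the `stub_mnVertical` census, assembly part 1 (B. Green, T. Tao, *Quadratic uniformity
of the Möbius function*, Ann. Inst. Fourier 58 (2008) = arXiv:math/0606087, §6, proof of Prop. 15: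
"We can divide the interval `{N+1,…,2N}` into `q` residue classes … Fix `s` … choose
`n_s ∈ X_s ∩ B_g(n₀,ρ)`.  We work in the group `ℤ/pℤ` where `p ∈ [10N, 20N]` … abusing notation by
regarding functions on `[N,2N]` as functions on `ℤ/pℤ` …").  Here the abuse of notation is made
honest: functions on `ℤ` are pulled back along the balanced lift `valMinAbs : ℤ/pℤ → (−p/2, p/2]`
(`p ≥ 10N`, so nothing wraps around on `supp ψ + H + H`), the weight is restricted to the residue
class, and the landed bricks are chained: the three-term consequence of approximate linearity
(`…MNTwoApproxLinear.norm_weight_phase_sub_le`) feeds the approximate-`U²`-duality averaging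
(`…MNTwoDualApproximation.norm_sum_le_of_approx_dual`), whose Fourier input is the `ℤ/pℤ`-reading
of Davenport on progressions (`…MNTwoMoebiusTransfer`).  The Bohr set `{h ∈ B_g(0,κ) : q ∣ h}` of the
paper is abstracted to any finite set `H ∋ 0` of shifts with `|h| ≤ N`, `q ∣ h`, and the Lipschitz
hypothesis on `ψ` to the shift bound `|ψ(n+h₁+h₂) − ψ(n)| ≤ w(n)`.  Def-free.

* `valMinAbs_eq_of_two_mul_abs_lt`, `valMinAbs_intCast_of_two_mul_abs_lt`, `valMinAbs_add_intCast`,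
  `le_of_valMinAbs_add_ne` — the balanced lift does not wrap on small elements;
* `sum_fiber_eq_sum_real` — real fibre sums;
* `norm_sum_class_le` — the estimate on one residue class mod `q`:
  `‖Σ_{N<n≤2N, n≡r (q)} μ(n)ψ(n)e(−φ(n))‖ ≤ Σ_{class} (6πεψ + w) + √(p/#H) · D`.

References: [GreenTao2008QuadraticMobius] arXiv:math/0606087 §6, proof of Proposition 15.
-/

noncomputable section

open Finset Real ArithmeticFunction
open scoped ArithmeticFunction.Moebius

namespace Summit.Parity.GeneralizedHardyLittlewood.GreenTaoLevelTwoMNTwoAlmostLinearClass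

open Summit.Parity.GeneralizedHardyLittlewood.GreenTaoLevelTwoMNTwoDualApproximation
  (norm_sum_le_of_approx_dual)
open Summit.Parity.GeneralizedHardyLittlewood.GreenTaoLevelTwoMNTwoApproxLinear
  (norm_weight_phase_sub_le)
open Summit.Parity.GeneralizedHardyLittlewood.GreenTaoLevelTwoMNTwoMoebiusTransfer
  (sum_fiber_eq_sum norm_sum_moebius_block_progression_le)

/-! ### §1 The balanced lift `ℤ/pℤ → ℤ` does not wrap on small elements -/

/-- The balanced lift `valMinAbs x ∈ (−p/2, p/2]` is the unique representative of `x` of absolute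
value `< p/2`: if `D ≡ x (mod p)` and `2|D| < p` then `valMinAbs x = D`. [folklore] -/
theorem valMinAbs_eq_of_two_mul_abs_lt {p : ℕ} [NeZero p] {x : ZMod p} {D : ℤ}
    (hDx : (D : ZMod p) = x) (hD : 2 * |D| < (p : ℤ)) : x.valMinAbs = D := by
  have h1 : ((D - x.valMinAbs : ℤ) : ZMod p) = 0 := by
    rw [Int.cast_sub, hDx, ZMod.coe_valMinAbs, sub_self]
  have h2 : (p : ℤ) ∣ D - x.valMinAbs := (ZMod.intCast_zmod_eq_zero_iff_dvd _ _).1 h1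
  have h3 : 2 * x.valMinAbs.natAbs ≤ p := by have := ZMod.natAbs_valMinAbs_le x; omega
  have h3' : 2 * |x.valMinAbs| ≤ (p : ℤ) := by
    have : ((2 * x.valMinAbs.natAbs : ℕ) : ℤ) ≤ p := by exact_mod_cast h3
    push_cast at this; exact this
  have h4 : D - x.valMinAbs = 0 := by
    refine Int.eq_zero_of_dvd_of_natAbs_lt_natAbs h2 ?_
    have h5 : |D - x.valMinAbs| < (p : ℤ) := by
      have := abs_sub D x.valMinAbs
      linarith
    have h6 : ((D - x.valMinAbs).natAbs : ℤ) < ((p : ℤ).natAbs : ℤ) := by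
      rw [Int.natCast_natAbs, Int.natCast_natAbs, abs_of_nonneg (by positivity : (0 : ℤ) ≤ p)]
      exact h5
    exact_mod_cast h6
  linarith

/-- `2 |valMinAbs x| ≤ p`. [folklore] -/
theorem two_mul_abs_valMinAbs_le {p : ℕ} [NeZero p] (x : ZMod p) : 2 * |x.valMinAbs| ≤ (p : ℤ) := by
  have h3 : 2 * x.valMinAbs.natAbs ≤ p := by have := ZMod.natAbs_valMinAbs_le x; omega
  have : ((2 * x.valMinAbs.natAbs : ℕ) : ℤ) ≤ p := by exact_mod_cast h3
  push_cast at this; exact this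

/-- A small integer is its own balanced representative. [folklore] -/
theorem valMinAbs_intCast_of_two_mul_abs_lt {p : ℕ} [NeZero p] {D : ℤ} (hD : 2 * |D| < (p : ℤ)) :
    ((D : ZMod p)).valMinAbs = D :=
  valMinAbs_eq_of_two_mul_abs_lt rfl hD

/-- No wrap-around: if `2(|valMinAbs x| + |h|) < p` then `valMinAbs (x + h) = valMinAbs x + h`.
[folklore] -/
theorem valMinAbs_add_intCast {p : ℕ} [NeZero p] (x : ZMod p) (h : ℤ)
    (hsmall : 2 * (|x.valMinAbs| + |h|) < (p : ℤ)) :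
    (x + (h : ZMod p)).valMinAbs = x.valMinAbs + h := by
  apply valMinAbs_eq_of_two_mul_abs_lt
  · push_cast
    simp
  · have := abs_add_le x.valMinAbs h
    linarith

/-- If a wrap-around occurs at `x` under the shift `h`, then both `x` and `x + h` are far from `0`:
`p ≤ 2(|valMinAbs x| + |h|)` and `p ≤ 2(|valMinAbs (x+h)| + |h|)`. [folklore] -/
theorem le_of_valMinAbs_add_ne {p : ℕ} [NeZero p] (x : ZMod p) (h : ℤ)
    (hne : (x + (h : ZMod p)).valMinAbs ≠ x.valMinAbs + h) :
    (p : ℤ) ≤ 2 * (|x.valMinAbs| + |h|) ∧ (p : ℤ) ≤ 2 * (|(x + (h : ZMod p)).valMinAbs| + |h|) := by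
  constructor
  · by_contra hlt
    exact hne (valMinAbs_add_intCast x h (not_le.1 hlt))
  · by_contra hlt
    have e := valMinAbs_add_intCast (x + (h : ZMod p)) (-h) (by rw [abs_neg]; exact not_le.1 hlt)
    have e2 : x + (h : ZMod p) + ((-h : ℤ) : ZMod p) = x := by push_cast; ring
    rw [e2] at e
    exact hne (by linarith)

/-! ### §2 One residue class, read in `ℤ/pℤ` -/

/-- Real-valued fibre sums over `ℤ/pℤ`. [folklore] -/
theorem sum_fiber_eq_sum_real {p : ℕ} [NeZero p] (S : Finset ℕ) (g : ℕ → ℝ) :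
    ∑ x : ZMod p, ∑ n ∈ S.filter (fun n : ℕ => ((n : ℕ) : ZMod p) = x), g n = ∑ n ∈ S, g n := by
  classical
  rw [← Finset.sum_fiberwise_of_maps_to (s := S) (t := (Finset.univ : Finset (ZMod p)))
    (g := fun n : ℕ => (n : ZMod p)) (fun n _ => mem_univ _)]

/-- **One residue class of GT 2008b Prop. 15 (explicit data).**  `N ≥ 1`, `p ≥ 10N`, `q ≥ 1`, a
residue `r`; admissible shifts `H ∋ 0` with `|h| ≤ N`, `q ∣ h`; `0 ≤ ψ ≤ 1` supported in `(N,2N]`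
with shift bound `|ψ(n+h₁+h₂) − ψ(n)| ≤ w(n)`; `S ⊇ supp ψ + H + H` on which `φ` is `ε`-almost
linear along `q`-divisible steps; `D` a bound for the `ℤ/pℤ`-Fourier coefficients of `μ` on the
class.  Then `‖Σ_{N<n≤2N, n≡r} μψe(−φ)‖ ≤ Σ_{class}(6πεψ + w) + √(p/#H)·D`.
[cite: GreenTao2008QuadraticMobius, proof of Proposition 15] -/
theorem norm_sum_class_le {N : ℕ} (hN : 1 ≤ N) (p : ℕ) [NeZero p] (hp : 10 * N ≤ p) (q : ℕ)
    (r : ℕ) (H : Finset ℤ) (h0H : (0 : ℤ) ∈ H)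
    (hH : ∀ h ∈ H, |h| ≤ N ∧ (q : ℤ) ∣ h)
    (ψ w : ℤ → ℝ) (φ : ℤ → UnitAddCircle) (S : Set ℤ) {ε : ℝ}
    (hψ0 : ∀ n, 0 ≤ ψ n) (hψ1 : ∀ n, ψ n ≤ 1) (hsupp : ∀ n, ψ n ≠ 0 → (N : ℤ) < n ∧ n ≤ 2 * N)
    (hw0 : ∀ n, 0 ≤ w n) (hw : ∀ n, ∀ h₁ ∈ H, ∀ h₂ ∈ H, |ψ (n + h₁ + h₂) - ψ n| ≤ w n)
    (hS : ∀ n, ψ n ≠ 0 → ∀ h₁ ∈ H, ∀ h₂ ∈ H, n + h₁ + h₂ ∈ S)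
    (hlin : ∀ x h₁ h₂ : ℤ, x ∈ S → x + h₁ ∈ S → x + h₂ ∈ S → x + h₁ + h₂ ∈ S →
      (q : ℤ) ∣ h₁ → (q : ℤ) ∣ h₂ → ‖φ (x + h₁ + h₂) - φ (x + h₁) - φ (x + h₂) + φ x‖ ≤ ε)
    {D : ℝ} (hD0 : 0 ≤ D)
    (hD : ∀ ξ : ZMod p, ‖∑ n ∈ (Ioc N (2 * N)).filter (fun n : ℕ => n % q = r),
      ((μ n : ℝ) : ℂ) * (ZMod.stdAddChar ((n : ZMod p) * ξ) : ℂ)‖ ≤ D) :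
    ‖∑ n ∈ (Ioc N (2 * N)).filter (fun n : ℕ => n % q = r),
        ((μ n : ℝ) : ℂ) * ((ψ n : ℝ) : ℂ) * ((AddCircle.toCircle (-φ n) : Circle) : ℂ)‖ ≤
      (∑ n ∈ (Ioc N (2 * N)).filter (fun n : ℕ => n % q = r), (6 * Real.pi * ε * ψ n + w n)) +
        Real.sqrt (p / #H) * D := by
  classical
  set Sr := (Ioc N (2 * N)).filter (fun n : ℕ => n % q = r) with hSr
  have hpZ : (10 * N : ℤ) ≤ p := by exact_mod_cast hp
  have hmemSr : ∀ n ∈ Sr, N < n ∧ n ≤ 2 * N ∧ n % q = r := by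
    intro n hn
    rw [hSr, mem_filter, mem_Ioc] at hn
    exact ⟨hn.1.1, hn.1.2, hn.2⟩
  -- the class residue as a divisibility in `ℤ`
  have hdvd_of_mod : ∀ n : ℕ, n % q = r → (q : ℤ) ∣ (n : ℤ) - r := by
    intro n hn
    refine ⟨(n / q : ℕ), ?_⟩
    have := Nat.div_add_mod n q
    rw [hn] at this
    have e : (n : ℤ) = q * (n / q : ℕ) + r := by exact_mod_cast this.symm
    rw [e]; ring
  have hterm0 : ∀ n : ℤ, ψ n ≠ 0 → 0 ≤ ε := fun n hn => by
    have h0 : n ∈ S := by simpa using hS n hn 0 h0H 0 h0H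
    exact (norm_nonneg _).trans (hlin n 0 0 h0 (by simpa using h0) (by simpa using h0)
      (by simpa using h0) (dvd_zero _) (dvd_zero _))
  -- trivial case: `ψ` vanishes on the class
  by_cases hne : ∃ n ∈ Sr, ψ n ≠ 0
  swap
  · push Not at hne
    have e0 : ∑ n ∈ Sr, ((μ n : ℝ) : ℂ) * ((ψ n : ℝ) : ℂ) * ((AddCircle.toCircle (-φ n) : Circle) : ℂ) = 0 :=
      Finset.sum_eq_zero fun n hn => by rw [hne n hn]; simp
    rw [e0, norm_zero]
    have h1 : 0 ≤ ∑ n ∈ Sr, (6 * Real.pi * ε * ψ n + w n) :=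
      Finset.sum_nonneg fun n hn => by rw [hne n hn]; simpa using hw0 n
    have h2 : 0 ≤ Real.sqrt (p / #H) * D := mul_nonneg (Real.sqrt_nonneg _) hD0
    linarith
  obtain ⟨ns, hnsSr, hψns⟩ := hne
  obtain ⟨hns1, hns2, hnsr⟩ := hmemSr ns hnsSr
  have hε : 0 ≤ ε := hterm0 ns hψns
  -- the transferred data on `ℤ/pℤ`
  set ψ' : ZMod p → ℝ := fun x => if (q : ℤ) ∣ ZMod.valMinAbs x - r then ψ (ZMod.valMinAbs x) else 0 with hψ'
  set φ' : ZMod p → UnitAddCircle := fun x => φ (ZMod.valMinAbs x) with hφ'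
  set κ' : ZMod p → ℝ := fun x => w (ZMod.valMinAbs x) with hκ'
  set a : ZMod p → ℂ := fun x => ∑ n ∈ Sr.filter (fun n : ℕ => ((n : ℕ) : ZMod p) = x), ((μ n : ℝ) : ℂ)
    with ha
  set f : ZMod p → ℂ := fun y => (ψ' y : ℂ) * ((AddCircle.toCircle (-φ' y) : Circle) : ℂ) with hf
  set nₛ : ZMod p := ((ns : ℤ) : ZMod p) with hnₛ
  set F : ZMod p → ℂ := fun h => ((AddCircle.toCircle (φ' (nₛ + h)) : Circle) : ℂ) with hF
  set c : ℂ := ((AddCircle.toCircle (-(2 • φ' nₛ)) : Circle) : ℂ) with hc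
  set H' : Finset (ZMod p) := H.image (fun h : ℤ => (h : ZMod p)) with hH'
  set w' : ZMod p → ℝ := fun x =>
    ∑ n ∈ Sr.filter (fun n : ℕ => ((n : ℕ) : ZMod p) = x), (6 * Real.pi * ε * ψ n + w n) with hw'
  -- balanced lifts of the relevant small integers
  have hιint : ∀ m : ℤ, |m| ≤ 4 * N → ZMod.valMinAbs (m : ZMod p) = m := by
    intro m hm
    exact valMinAbs_intCast_of_two_mul_abs_lt (by linarith)
  have hιnat : ∀ n : ℕ, n ≤ 2 * N → ZMod.valMinAbs ((n : ℕ) : ZMod p) = n := by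
    intro n hn
    have e : ((n : ℕ) : ZMod p) = ((n : ℤ) : ZMod p) := by push_cast; rfl
    rw [e]
    apply hιint
    rw [abs_of_nonneg (by positivity)]
    exact_mod_cast (by omega : n ≤ 4 * N)
  have hιx : ∀ x : ZMod p, ((ZMod.valMinAbs x : ℤ) : ZMod p) = x := fun x => ZMod.coe_valMinAbs x
  have hιabs : ∀ x : ZMod p, 2 * |ZMod.valMinAbs x| ≤ (p : ℤ) := fun x => two_mul_abs_valMinAbs_le x
  have hιns : ZMod.valMinAbs nₛ = ns := by
    rw [hnₛ]; apply hιint; rw [abs_of_nonneg (by positivity)]; exact_mod_cast (by omega : ns ≤ 4 * N)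
  have hmemH' : ∀ h' ∈ H', ∃ h ∈ H, (h : ZMod p) = h' := fun h' hh' => by
    simpa [hH', mem_image] using hh'
  -- elements of `supp ψ` shifted twice by `H` stay within `|·| ≤ 4N`
  have hshift : ∀ n : ℤ, (N : ℤ) < n ∧ n ≤ 2 * N → ∀ h₁ ∈ H, ∀ h₂ ∈ H, |n + h₁ + h₂| ≤ 4 * N := by
    intro n hn h₁ hh₁ h₂ hh₂
    have := (hH h₁ hh₁).1; have := (hH h₂ hh₂).1
    rw [abs_le] at *
    constructor <;> linarith
  have hψ'0 : ∀ x, 0 ≤ ψ' x := fun x => by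
    simp only [hψ']; split_ifs
    · exact hψ0 _
    · exact le_rfl
  have hψ'1 : ∀ x, ψ' x ≤ 1 := fun x => by
    simp only [hψ']; split_ifs
    · exact hψ1 _
    · exact zero_le_one
  have hfle : ∀ y, ‖f y‖ ≤ 1 := fun y => by
    simp only [hf]
    rw [norm_mul, Circle.norm_coe, mul_one, Complex.norm_real, Real.norm_eq_abs,
      abs_of_nonneg (hψ'0 y)]
    exact hψ'1 y
  have hFle : ∀ h ∈ H', ‖F h‖ ≤ 1 := fun h _ => by simp only [hF]; rw [Circle.norm_coe]
  have hDa : ∀ ξ : ZMod p, ‖∑ x : ZMod p, a x * (ZMod.stdAddChar (x * ξ) : ℂ)‖ ≤ D := by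
    intro ξ
    simp only [ha]
    rw [sum_fiber_eq_sum Sr (fun n => ((μ n : ℝ) : ℂ)) (fun x => (ZMod.stdAddChar (x * ξ) : ℂ))]
    exact hD ξ
  have hH'ne : H'.Nonempty := ⟨((0 : ℤ) : ZMod p), mem_image.2 ⟨0, h0H, rfl⟩⟩
  have hcardH' : #H' = #H := by
    rw [hH']
    refine Finset.card_image_of_injOn fun h₁ hh₁ h₂ hh₂ heq => ?_
    have e1 := hιint h₁ (by have := (hH h₁ hh₁).1; linarith)
    have e2 := hιint h₂ (by have := (hH h₂ hh₂).1; linarith)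
    have heq' : (h₁ : ZMod p) = (h₂ : ZMod p) := heq
    rw [← e1, ← e2, heq']
  -- (d) the shift bound for `ψ'`
  have hψ'shift : ∀ x, ∀ h₁ ∈ H', ∀ h₂ ∈ H', |ψ' (x + h₁ + h₂) - ψ' x| ≤ κ' x := by
    intro x h₁' hh₁' h₂' hh₂'
    obtain ⟨h₁, hh₁, rfl⟩ := hmemH' h₁' hh₁'
    obtain ⟨h₂, hh₂, rfl⟩ := hmemH' h₂' hh₂'
    have hhabs : |h₁ + h₂| ≤ 2 * N := by
      have := (hH h₁ hh₁).1; have := (hH h₂ hh₂).1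
      have := abs_add_le h₁ h₂; linarith
    have hqh : (q : ℤ) ∣ h₁ + h₂ := dvd_add (hH h₁ hh₁).2 (hH h₂ hh₂).2
    have exh : x + (h₁ : ZMod p) + (h₂ : ZMod p) = x + ((h₁ + h₂ : ℤ) : ZMod p) := by push_cast; ring
    rw [exh]
    simp only [hκ']
    by_cases hwrap : (x + ((h₁ + h₂ : ℤ) : ZMod p)).valMinAbs = x.valMinAbs + (h₁ + h₂)
    · -- no wrap-around
      simp only [hψ']
      rw [hwrap]
      by_cases hcl : (q : ℤ) ∣ x.valMinAbs - r
      · have hcl2 : (q : ℤ) ∣ x.valMinAbs + (h₁ + h₂) - r := by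
          have : x.valMinAbs + (h₁ + h₂) - r = (x.valMinAbs - r) + (h₁ + h₂) := by ring
          rw [this]; exact dvd_add hcl hqh
        rw [if_pos hcl2, if_pos hcl, ← add_assoc]
        exact hw _ h₁ hh₁ h₂ hh₂
      · have hcl2 : ¬ (q : ℤ) ∣ x.valMinAbs + (h₁ + h₂) - r := by
          intro h
          apply hcl
          have : x.valMinAbs - r = (x.valMinAbs + (h₁ + h₂) - r) - (h₁ + h₂) := by ring
          rw [this]; exact dvd_sub h hqh
        rw [if_neg hcl2, if_neg hcl, sub_zero, abs_zero]
        exact hw0 _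
    · -- wrap-around: both values of `ψ` vanish
      obtain ⟨hfar1, hfar2⟩ := le_of_valMinAbs_add_ne x (h₁ + h₂) hwrap
      have hz1 : ψ (ZMod.valMinAbs x) = 0 := by
        by_contra hne1
        have h12 := hsupp _ hne1
        have : |ZMod.valMinAbs x| ≤ 2 * N := abs_le.2 ⟨by linarith [h12.1], h12.2⟩
        linarith
      have hz2 : ψ (ZMod.valMinAbs (x + ((h₁ + h₂ : ℤ) : ZMod p))) = 0 := by
        by_contra hne2
        have h12 := hsupp _ hne2
        have : |ZMod.valMinAbs (x + ((h₁ + h₂ : ℤ) : ZMod p))| ≤ 2 * N :=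
          abs_le.2 ⟨by linarith [h12.1], h12.2⟩
        linarith
      have e1 : ψ' x = 0 := by simp only [hψ', hz1, ite_self]
      have e2 : ψ' (x + ((h₁ + h₂ : ℤ) : ZMod p)) = 0 := by simp only [hψ', hz2, ite_self]
      rw [e1, e2, sub_zero, abs_zero]
      exact hw0 _
  -- (e) the three-term consequence of approximate linearity for `φ'`
  have hφ'lin : ∀ x, ψ' x ≠ 0 → ∀ h₁ ∈ H', ∀ h₂ ∈ H',
      ‖φ' x - φ' (x + h₁ + h₂) + φ' (nₛ + h₁) + φ' (nₛ + h₂) - 2 • φ' nₛ‖ ≤ 3 * ε := by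
    intro x hx h₁' hh₁' h₂' hh₂'
    obtain ⟨h₁, hh₁, rfl⟩ := hmemH' h₁' hh₁'
    obtain ⟨h₂, hh₂, rfl⟩ := hmemH' h₂' hh₂'
    have hcl : (q : ℤ) ∣ ZMod.valMinAbs x - r := by
      by_contra h; apply hx; simp only [hψ']; rw [if_neg h]
    have hψn : ψ (ZMod.valMinAbs x) ≠ 0 := by
      intro h; apply hx; simp only [hψ']; rw [if_pos hcl, h]
    set n : ℤ := ZMod.valMinAbs x with hn
    have hnN := hsupp n hψn
    have hnsN : (N : ℤ) < (ns : ℤ) ∧ (ns : ℤ) ≤ 2 * N := ⟨by exact_mod_cast hns1, by exact_mod_cast hns2⟩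
    have ex : x = ((n : ℤ) : ZMod p) := (hιx x).symm
    have l1 : ZMod.valMinAbs (x + (h₁ : ZMod p) + (h₂ : ZMod p)) = n + h₁ + h₂ := by
      rw [ex]
      have e : ((n : ℤ) : ZMod p) + (h₁ : ZMod p) + (h₂ : ZMod p) = ((n + h₁ + h₂ : ℤ) : ZMod p) := by
        push_cast; ring
      rw [e]; exact hιint _ (hshift n hnN h₁ hh₁ h₂ hh₂)
    have l2 : ∀ h ∈ H, ZMod.valMinAbs (nₛ + (h : ZMod p)) = ns + h := by
      intro h hh
      rw [hnₛ]
      have e : ((ns : ℤ) : ZMod p) + (h : ZMod p) = (((ns : ℤ) + h + 0 : ℤ) : ZMod p) := by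
        push_cast; ring
      rw [e, hιint _ (hshift _ hnsN h hh 0 h0H)]; ring
    -- memberships in `S`
    have mn : n ∈ S := by simpa using hS n hψn 0 h0H 0 h0H
    have mn1 : n + h₁ ∈ S := by simpa using hS n hψn h₁ hh₁ 0 h0H
    have mn2 : n + h₂ ∈ S := by simpa using hS n hψn h₂ hh₂ 0 h0H
    have mn12 : n + h₁ + h₂ ∈ S := hS n hψn h₁ hh₁ h₂ hh₂
    have ms : (ns : ℤ) ∈ S := by simpa using hS ns hψns 0 h0H 0 h0H
    have ms1 : (ns : ℤ) + h₁ ∈ S := by simpa using hS ns hψns h₁ hh₁ 0 h0H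
    have ms2 : (ns : ℤ) + h₂ ∈ S := by simpa using hS ns hψns h₂ hh₂ 0 h0H
    -- `q ∣ n − ns`
    have hqd : (q : ℤ) ∣ n - ns := by
      have h2 := hdvd_of_mod ns hnsr
      have : n - ns = (n - r) - ((ns : ℤ) - r) := by ring
      rw [this]; exact dvd_sub hcl h2
    -- three applications of `hlin`
    have L3 := hlin n h₁ h₂ mn mn1 mn2 mn12 (hH h₁ hh₁).2 (hH h₂ hh₂).2
    have e1 : (ns : ℤ) + h₁ + (n - ns) = n + h₁ := by ring
    have e2 : (ns : ℤ) + h₂ + (n - ns) = n + h₂ := by ring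
    have e3 : (ns : ℤ) + (n - ns) = n := by ring
    have ms3 : (ns : ℤ) + (n - ns) ∈ S := by rw [e3]; exact mn
    have ms13 : (ns : ℤ) + h₁ + (n - ns) ∈ S := by rw [e1]; exact mn1
    have ms23 : (ns : ℤ) + h₂ + (n - ns) ∈ S := by rw [e2]; exact mn2
    have L1 := hlin ns h₁ (n - ns) ms ms1 ms3 ms13 (hH h₁ hh₁).2 hqd
    have L2 := hlin ns h₂ (n - ns) ms ms2 ms3 ms23 (hH h₂ hh₂).2 hqd
    rw [e1, e3] at L1
    rw [e2, e3] at L2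
    -- rewrite the target in terms of `φ` on `ℤ`
    simp only [hφ']
    rw [l1, l2 h₁ hh₁, l2 h₂ hh₂, hιns]
    have key : φ n - φ (n + h₁ + h₂) + φ ((ns : ℤ) + h₁) + φ ((ns : ℤ) + h₂) - 2 • φ (ns : ℤ) =
        -((φ (n + h₁ + h₂) - φ (n + h₁) - φ (n + h₂) + φ n) +
          (φ (n + h₁) - φ ((ns : ℤ) + h₁) - φ n + φ (ns : ℤ)) +
          (φ (n + h₂) - φ ((ns : ℤ) + h₂) - φ n + φ (ns : ℤ))) := by
      rw [two_nsmul]; abel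
    rw [key, norm_neg]
    calc _ ≤ ‖(φ (n + h₁ + h₂) - φ (n + h₁) - φ (n + h₂) + φ n) +
          (φ (n + h₁) - φ ((ns : ℤ) + h₁) - φ n + φ (ns : ℤ))‖ +
          ‖φ (n + h₂) - φ ((ns : ℤ) + h₂) - φ n + φ (ns : ℤ)‖ := norm_add_le _ _
      _ ≤ (‖φ (n + h₁ + h₂) - φ (n + h₁) - φ (n + h₂) + φ n‖ +
          ‖φ (n + h₁) - φ ((ns : ℤ) + h₁) - φ n + φ (ns : ℤ)‖) +
          ‖φ (n + h₂) - φ ((ns : ℤ) + h₂) - φ n + φ (ns : ℤ)‖ :=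
          add_le_add (norm_add_le _ _) le_rfl
      _ ≤ (ε + ε) + ε := add_le_add (add_le_add L3 L1) L2
      _ = 3 * ε := by ring
  -- (f) the pointwise approximate duality `happrox`
  have happrox : ∀ x, ∀ h₁ ∈ H', ∀ h₂ ∈ H',
      ‖a x * f x - c * (a x * F h₁ * F h₂ * f (x + h₁ + h₂))‖ ≤ w' x := by
    intro x h₁ hh₁ h₂ hh₂
    have step := norm_weight_phase_sub_le φ' ψ' κ' a H' nₛ hψ'0 hφ'lin hψ'shift x hh₁ hh₂
    refine step.trans ?_
    -- fibre analysis: every `n` in the fibre of `x` equals `ZMod.valMinAbs x`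
    set Fx := Sr.filter (fun n : ℕ => ((n : ℕ) : ZMod p) = x) with hFx
    have hfib : ∀ n ∈ Fx, ZMod.valMinAbs x = n ∧ n % q = r := by
      intro n hn
      rw [hFx, mem_filter] at hn
      obtain ⟨hnSr, hnx⟩ := hn
      obtain ⟨_, hn2, hn3⟩ := hmemSr n hnSr
      exact ⟨by rw [← hnx]; exact hιnat n hn2, hn3⟩
    have hval : ∀ n ∈ Fx, 2 * Real.pi * (3 * ε) * ψ' x + κ' x = 6 * Real.pi * ε * ψ n + w n := by
      intro n hn
      obtain ⟨h1, h2⟩ := hfib n hn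
      simp only [hψ', hκ']
      rw [h1, if_pos (hdvd_of_mod n h2)]
      ring
    have hnn : 0 ≤ 2 * Real.pi * (3 * ε) * ψ' x + κ' x := by
      have := hψ'0 x; have := hw0 (ZMod.valMinAbs x); simp only [hκ']; positivity
    have ha_le : ‖a x‖ ≤ ∑ n ∈ Fx, (1 : ℝ) := by
      simp only [ha]
      refine (norm_sum_le _ _).trans (Finset.sum_le_sum fun n _ => ?_)
      rw [Complex.norm_real, Real.norm_eq_abs]
      exact_mod_cast abs_moebius_le_one
    calc ‖a x‖ * (2 * Real.pi * (3 * ε) * ψ' x + κ' x)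
        ≤ (∑ n ∈ Fx, (1 : ℝ)) * (2 * Real.pi * (3 * ε) * ψ' x + κ' x) :=
          mul_le_mul_of_nonneg_right ha_le hnn
      _ = ∑ n ∈ Fx, (2 * Real.pi * (3 * ε) * ψ' x + κ' x) := by
          rw [Finset.sum_const, Finset.sum_const, nsmul_eq_mul, nsmul_eq_mul, mul_one]
      _ = ∑ n ∈ Fx, (6 * Real.pi * ε * ψ n + w n) := Finset.sum_congr rfl hval
      _ = w' x := by simp only [hw', hFx]
  have main := norm_sum_le_of_approx_dual H' hH'ne a f F c w' hfle hFle hD0 hDa happrox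
  -- (h) read the conclusion back in `ℤ`
  have eL : ∑ x : ZMod p, a x * f x =
      ∑ n ∈ Sr, ((μ n : ℝ) : ℂ) * ((ψ n : ℝ) : ℂ) * ((AddCircle.toCircle (-φ n) : Circle) : ℂ) := by
    simp only [ha]
    rw [sum_fiber_eq_sum Sr (fun n => ((μ n : ℝ) : ℂ)) f]
    refine Finset.sum_congr rfl fun n hn => ?_
    obtain ⟨_, hn2, hn3⟩ := hmemSr n hn
    simp only [hf, hψ', hφ']
    rw [hιnat n hn2, if_pos (hdvd_of_mod n hn3)]
    ring
  have eW : ∑ x : ZMod p, w' x = ∑ n ∈ Sr, (6 * Real.pi * ε * ψ n + w n) := by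
    simp only [hw']
    exact sum_fiber_eq_sum_real Sr _
  have hcn : ‖c‖ = 1 := by simp only [hc]; exact Circle.norm_coe _
  rw [eL, eW, hcn, one_mul, hcardH'] at main
  exact main

end Summit.Parity.GeneralizedHardyLittlewood.GreenTaoLevelTwoMNTwoAlmostLinearClass
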